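import Summits.ResolutionOfSingularities.ResolutionOfSingularities.Theorems.EquisingularLiftEquisingularLiftNatMarkedVertex
import Summits.ResolutionOfSingularities.ResolutionOfSingularities.Theorems.EquisingularLiftEquisingularLiftNatSecondOrderD4Marked
import Summits.ResolutionOfSingularities.ResolutionOfSingularities.Theorems.EquisingularLiftEquisingularLiftNatTwoStepVertices
import HarnessLib

/-!
# [OURS] `D₄` VERTICES ARE TWO-STEP POINTS; SEVERAL ONE-STEP AND MARKED TWO-STEP (e.g. `D₄`) VERTICES ⟹ `IsoHypPoint` — the multi-root level-1 bridge
# closed end to end (polynomial `D₄` datum ✓ …NatSecondOrderD4Marked ⟹ ✓ `twoStepAt_vertex_marked` ⟹ ✓ `isoHypPoint_of_twoStepPoints`)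
# (cruxes `Theses.EquisingularLift.EquisingularLiftNat` / `…NatThree` / `EquisingularLift`, stmt-ResolutionOfSingularities-20038 / -20148 / -15660)

[OURS · leafhand-res-equisingularlift-12 g0, 2026-08-31; cell `pub/decomp-res`] AI-produced, weaker than expert review; NOT a statement of any manuscript;
nothing here proves resolution of singularities in positive characteristic.  DEF-FREE helper; no `sorry`; standard axioms; ZERO named hypotheses.

leafhand-11's remaining list item «[M] D₄ (multi-root generalisation of AffineTwoStepCharts)», CLOSED:

* `SecondOrderPoint.D₄_singular_only_origin` — the specimen chart `y₀² + (y₁³ + y₂³)` (`6 ≠ 0`) is singular at most at its origin (Jacobian hypothesis `hsing`);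
* ★★★ `twoStepAt_vertex_D₄` — `F` a form of positive degree whose vertex chart `F(x_c := 1)` is `y₀² + (y₁³ + y₂³)` (radical), `2, 3 ≠ 0` in `K`, `t³ + 1` split:
  the point of `V₊(F)` over `P_c` is a closed TWO-STEP point (every blow-up at it is regular over it except at finitely many closed ONE-STEP points — the
  three `A₁` points);
* ★★★ `isoHypPoint_of_twoStepVertices_marked` — ✓ `isoHypPoint_of_twoStepVertices` with the two-step vertices carrying MARKED data;
* ★★ `isoHypPoint_of_D₄Vertices` — a prime surface `V₊(F) ⊆ ℙ³_K̄` (`char K ≠ 2, 3`) whose singular points are coordinate vertices of type «one-step» or with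
  vertex chart `y₀² + (y₁³ + y₂³)` satisfies `IsoHypPoint` (the lead's hypothesis #7): such `H` are OUTSIDE the isolated residual.

Honest label: closes no registered stub.

References: [Hartshorne1977, I Thm. 5.1, I Ex. 5.6, II Ex. 7.12]; [StacksProject, Tags 0804, 080E]; [Lipman1969, §24]; through the cited tree files.
-/

set_option linter.dupNamespace false -- mandated namespace `Summit.<Summit>.<Problem>` of this single-conjunct summit

noncomputable section

open CategoryTheory CategoryTheory.Limits AlgebraicGeometry TopologicalSpace
open Literature.AlgebraicGeometry.Resolution Literature.AlgebraicGeometry.Motives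
open AlgebraicGeometry.Scheme.IdealSheafData
open MvPolynomial HomogeneousLocalization
open Literature.AlgebraicGeometry.Motives.SmoothHypersurface Literature.AlgebraicGeometry.Motives.ProjectiveSpace
open Summit.ResolutionOfSingularities.ResolutionOfSingularities.Cruxes.EquisingularLift.StrataSplit

namespace Summit.ResolutionOfSingularities.ResolutionOfSingularities.Cruxes.EquisingularLiftNat.Sections

/-- **The `D₄` specimen chart is singular at most at its origin** (`2, 3 ≠ 0`): `∂₀ = 2y₀`, `∂₁ = 3y₁²`, `∂₂ = 3y₂²`. [cite: Hartshorne1977, I Thm. 5.1] -/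
theorem SecondOrderPoint.D₄_singular_only_origin (K : Type) [Field K] (h2 : (2 : K) ≠ 0) (h3 : (3 : K) ≠ 0)
    (P : Ideal (MvPolynomial (Fin 3) K)) (hP : P.IsPrime) (_hf : (X 0 ^ 2 + (X 1 ^ 3 + X 2 ^ 3) : MvPolynomial (Fin 3) K) ∈ P)
    (hd : ∀ j, pderiv j (X 0 ^ 2 + (X 1 ^ 3 + X 2 ^ 3) : MvPolynomial (Fin 3) K) ∈ P) (j : Fin 3) :
    (X j : MvPolynomial (Fin 3) K) ∈ P := by
  have hd0 : pderiv 0 (X 0 ^ 2 + (X 1 ^ 3 + X 2 ^ 3) : MvPolynomial (Fin 3) K) = C 2 * X 0 := by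
    rw [map_add, map_add, pderiv_pow, pderiv_X_self, pderiv_pow, pderiv_X_of_ne (by decide : (1 : Fin 3) ≠ 0), pderiv_pow,
      pderiv_X_of_ne (by decide : (2 : Fin 3) ≠ 0), map_ofNat]
    ring
  have hd1 : pderiv 1 (X 0 ^ 2 + (X 1 ^ 3 + X 2 ^ 3) : MvPolynomial (Fin 3) K) = C 3 * X 1 ^ 2 := by
    rw [map_add, map_add, pderiv_pow, pderiv_X_of_ne (by decide : (0 : Fin 3) ≠ 1), pderiv_pow, pderiv_X_self, pderiv_pow,
      pderiv_X_of_ne (by decide : (2 : Fin 3) ≠ 1), map_ofNat]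
    ring
  have hd2 : pderiv 2 (X 0 ^ 2 + (X 1 ^ 3 + X 2 ^ 3) : MvPolynomial (Fin 3) K) = C 3 * X 2 ^ 2 := by
    rw [map_add, map_add, pderiv_pow, pderiv_X_of_ne (by decide : (0 : Fin 3) ≠ 2), pderiv_pow, pderiv_X_of_ne (by decide : (1 : Fin 3) ≠ 2),
      pderiv_pow, pderiv_X_self, map_ofNat]
    ring
  have hX0 : (X 0 : MvPolynomial (Fin 3) K) ∈ P := SecondOrderPoint.mem_of_C_mul_mem K h2 P hP (by rw [← hd0]; exact hd 0)
  have hX1 : (X 1 : MvPolynomial (Fin 3) K) ∈ P :=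
    hP.mem_of_pow_mem 2 (SecondOrderPoint.mem_of_C_mul_mem K h3 P hP (by rw [← hd1]; exact hd 1))
  have hX2 : (X 2 : MvPolynomial (Fin 3) K) ∈ P :=
    hP.mem_of_pow_mem 2 (SecondOrderPoint.mem_of_C_mul_mem K h3 P hP (by rw [← hd2]; exact hd 2))
  fin_cases j
  · simpa using hX0
  · simpa using hX1
  · simpa using hX2

/-- ★★★ **THE MARKED TWO-STEP DATA OF THE `D₄` SPECIMEN `y₀² + (y₁³ + y₂³)`** (corrected shape: ✓ `twoStepData_D₄_marked` of …NatSecondOrderD4Marked states the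
one-step clause with the literal exponent `2` in place of the bound `μ'`, which does not match the consumers; same proof) — VERBATIM the hypotheses `hΨ`, `G, hG`, `Λ, hjac, hsec` of
✓ `OneStep.twoStepAt_origin_marked` / ✓ `twoStepAt_vertex_marked` (`μ = 2`, `Φ = y₀²`): marks `Λ 0 = ∅`, `Λ 1 = {(0,0,ζ_k)}`, `Λ 2 = {(0,ζ_k,0)}`, every
translate an `A₁`.  Hypotheses: `2 ≠ 0`, `3 ≠ 0` in `K` and `ζ : Fin 3 → K` splitting `t³ + 1`. [OURS] [cite: Hartshorne1977, I Thm. 5.1, I Ex. 5.6, II Ex. 7.12] -/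
theorem SecondOrderPoint.twoStepData_D₄_marked' (K : Type) [Field K] (h2 : (2 : K) ≠ 0) (h3 : (3 : K) ≠ 0) (ζ : Fin 3 → K) (hζ : ∀ k, ζ k ^ 3 = -1)
    (hfac : ∀ i : Fin 3, ((X i - C (ζ 0)) * (X i - C (ζ 1)) * (X i - C (ζ 2)) : MvPolynomial (Fin 3) K) = X i ^ 3 + 1) :
    (X 1 ^ 3 + X 2 ^ 3 : MvPolynomial (Fin 3) K) ∈ Ideal.span (Set.range (X : Fin 3 → MvPolynomial (Fin 3) K)) ^ (2 + 1) ∧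
    ∃ (G : Fin 3 → MvPolynomial (Fin 3) K) (Λ : Fin 3 → Finset (Fin 3 → K)),
      (∀ a, aeval (fun j => X a * Function.update (X : Fin 3 → MvPolynomial (Fin 3) K) a 1 j)
        (X 0 ^ 2 + (X 1 ^ 3 + X 2 ^ 3) : MvPolynomial (Fin 3) K) = X a ^ 2 * G a) ∧
      (∀ a, ∀ P : Ideal (MvPolynomial (Fin 3) K), P.IsPrime → (X a : MvPolynomial (Fin 3) K) ∈ P → G a ∈ P →
        (∃ j, pderiv j (G a) ∉ P) ∨ ∃ lam ∈ Λ a, ∀ i, (X i - C (lam i) : MvPolynomial (Fin 3) K) ∈ P) ∧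
      (∀ a, ∀ lam ∈ Λ a, G a ∈ Ideal.span (Set.range fun i : Fin 3 => (X i - C (lam i) : MvPolynomial (Fin 3) K)) →
        ∃ (μ' : ℕ) (Φ' Ψ' : MvPolynomial (Fin 3) K), 1 ≤ μ' ∧ Φ'.IsHomogeneous μ' ∧ Φ' ≠ 0 ∧
          Ψ' ∈ Ideal.span (Set.range (X : Fin 3 → MvPolynomial (Fin 3) K)) ^ (μ' + 1) ∧
          aeval (fun i => X i + C (lam i)) (G a) = Φ' + Ψ' ∧
          ∀ b : Fin 3, ∃ G' : MvPolynomial (Fin 3) K,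
            aeval (fun j => X b * Function.update (X : Fin 3 → MvPolynomial (Fin 3) K) b 1 j) (Φ' + Ψ') = X b ^ μ' * G' ∧
            ∀ P : Ideal (MvPolynomial (Fin 3) K), P.IsPrime → (X b : MvPolynomial (Fin 3) K) ∈ P → G' ∈ P → ∃ j, pderiv j G' ∉ P) := by
  classical
  obtain ⟨hG0, hG1, hG2⟩ := D₄_strictTransform K
  set I : Ideal (MvPolynomial (Fin 3) K) := Ideal.span (Set.range (X : Fin 3 → MvPolynomial (Fin 3) K)) with hI
  have hX : ∀ i : Fin 3, (X i : MvPolynomial (Fin 3) K) ∈ I := fun i => Ideal.subset_span (Set.mem_range_self i)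
  have hζ0 : ∀ k, ζ k ≠ 0 := fun k h => by
    have := hζ k
    rw [h] at this
    norm_num at this
  have hc : ∀ k, (3 * ζ k ^ 2 : K) ≠ 0 := fun k => mul_ne_zero h3 (pow_ne_zero 2 (hζ0 k))
  -- one-step data at a mark, both charts
  have hcone := fun k => D₄_cone_isHomogeneous_ne_zero K (3 * ζ k ^ 2)
  refine ⟨D₄_tail_mem_pow K, ![1 + X 0 * (X 1 ^ 3 + X 2 ^ 3), X 0 ^ 2 + X 1 * (1 + X 2 ^ 3), X 0 ^ 2 + X 2 * (1 + X 1 ^ 3)],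
    ![∅, Finset.univ.image fun k : Fin 3 => (Pi.single (2 : Fin 3) (ζ k) : Fin 3 → K),
      Finset.univ.image fun k : Fin 3 => (Pi.single (1 : Fin 3) (ζ k) : Fin 3 → K)], ?_, ?_, ?_⟩
  · intro a
    fin_cases a
    · exact hG0
    · exact hG1
    · exact hG2
  · intro a P hP haP hGP
    fin_cases a
    · exact (D₄_jac₀ K P hP haP hGP).elim
    · exact D₄_jac₁ K h2 ζ (hfac 2) _ (fun k => Finset.mem_image.mpr ⟨k, Finset.mem_univ _, rfl⟩) P hP haP hGP
    · exact D₄_jac₂ K h2 ζ (hfac 1) _ (fun k => Finset.mem_image.mpr ⟨k, Finset.mem_univ _, rfl⟩) P hP haP hGP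
  · intro a lam hlam _hGa
    fin_cases a
    · simp at hlam
    · obtain ⟨k, -, rfl⟩ := Finset.mem_image.mp hlam
      refine ⟨2, X 0 ^ 2 + C (3 * ζ k ^ 2) * (X 1 * X 2), C (3 * ζ k) * (X 1 * X 2 ^ 2) + X 1 * X 2 ^ 3, by norm_num, (hcone k).1, (hcone k).2,
        ?_, D₄_translate₁ K (ζ k) (hζ k), fun b => ?_⟩
      · refine Ideal.add_mem _ (Ideal.mul_mem_left _ _ ?_) ?_
        · have e : I ^ (2 + 1) = I * I ^ 2 := by rw [pow_succ']
          rw [e]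
          exact Ideal.mul_mem_mul (hX 1) (Ideal.pow_mem_pow (hX 2) 2)
        · refine Ideal.pow_le_pow_right (by norm_num : 2 + 1 ≤ 4) ?_
          have e : I ^ 4 = I * I ^ 3 := by rw [pow_succ']
          rw [e]
          exact Ideal.mul_mem_mul (hX 1) (Ideal.pow_mem_pow (hX 2) 3)
      · refine D₄_exceptional_oneStep K h2 (hc k) _ _ ?_ ?_ b
        · simpa using (isHomogeneous_C (Fin 3) (3 * ζ k)).mul ((isHomogeneous_X K (1 : Fin 3)).mul (isHomogeneous_X_pow (2 : Fin 3) 2))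
        · have e : I ^ 4 = I * I ^ 3 := by rw [pow_succ']
          rw [e]
          exact Ideal.mul_mem_mul (hX 1) (Ideal.pow_mem_pow (hX 2) 3)
    · obtain ⟨k, -, rfl⟩ := Finset.mem_image.mp hlam
      refine ⟨2, X 0 ^ 2 + C (3 * ζ k ^ 2) * (X 1 * X 2), C (3 * ζ k) * (X 1 ^ 2 * X 2) + X 1 ^ 3 * X 2, by norm_num, (hcone k).1, (hcone k).2,
        ?_, D₄_translate₂ K (ζ k) (hζ k), fun b => ?_⟩
      · refine Ideal.add_mem _ (Ideal.mul_mem_left _ _ ?_) ?_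
        · have e : I ^ (2 + 1) = I ^ 2 * I := by rw [pow_succ]
          rw [e]
          exact Ideal.mul_mem_mul (Ideal.pow_mem_pow (hX 1) 2) (hX 2)
        · refine Ideal.pow_le_pow_right (by norm_num : 2 + 1 ≤ 4) ?_
          have e : I ^ 4 = I ^ 3 * I := by rw [pow_succ]
          rw [e]
          exact Ideal.mul_mem_mul (Ideal.pow_mem_pow (hX 1) 3) (hX 2)
      · refine D₄_exceptional_oneStep K h2 (hc k) _ _ ?_ ?_ b
        · simpa using (isHomogeneous_C (Fin 3) (3 * ζ k)).mul ((isHomogeneous_X_pow (1 : Fin 3) 2).mul (isHomogeneous_X K (2 : Fin 3)))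
        · have e : I ^ 4 = I ^ 3 * I := by rw [pow_succ]
          rw [e]
          exact Ideal.mul_mem_mul (Ideal.pow_mem_pow (hX 1) 3) (hX 2)


/-- ★★★ **`D₄` VERTICES ARE TWO-STEP POINTS.**  `F ∈ K[x₀,…,x₃]` a form of positive degree, `c` a coordinate whose vertex chart is the `D₄` specimen
`F(x_c := 1) = y₀² + (y₁³ + y₂³)` (the chart radical), `2, 3 ≠ 0` in `K`, `t³ + 1 = ∏ (t − ζ_k)`.  Then the point `x₀ ∈ V₊(F)` over `P_c` is a closed
TWO-STEP point — ✓ `twoStepAt_vertex_marked` fed with `SecondOrderPoint.twoStepData_D₄_marked'`. [OURS] [cite: Hartshorne1977, I Thm. 5.1, I Ex. 5.6] -/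
theorem twoStepAt_vertex_D₄ (K : Type) [Field K] (F : MvPolynomial (Fin (1 + 2 + 1)) K) {d : ℕ} (hF : F.IsHomogeneous d) (hd : 0 < d)
    (c : Fin (1 + 2 + 1)) (h2 : (2 : K) ≠ 0) (h3 : (3 : K) ≠ 0) (ζ : Fin 3 → K) (hζ : ∀ k, ζ k ^ 3 = -1)
    (hfac : ∀ i : Fin 3, ((X i - C (ζ 0)) * (X i - C (ζ 1)) * (X i - C (ζ 2)) : MvPolynomial (Fin 3) K) = X i ^ 3 + 1)
    (hdeh : ProjectiveSpace.dehomogenize K c F = X 0 ^ 2 + (X 1 ^ 3 + X 2 ^ 3))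
    (hrad : (Ideal.span {(X 0 ^ 2 + (X 1 ^ 3 + X 2 ^ 3) : MvPolynomial (Fin 3) K)}).radical =
      Ideal.span {(X 0 ^ 2 + (X 1 ^ 3 + X 2 ^ 3) : MvPolynomial (Fin 3) K)}) :
    letI := MvPolynomial.gradedAlgebra (σ := Fin (1 + 2 + 1)) (R := K)
    ∃ (x₀ : ↥(hypersurface F).left) (hx₀cl : IsClosed ({x₀} : Set ↥(hypersurface F).left)),
      (∀ a : Fin (1 + 2 + 1), a ≠ c → (X a : MvPolynomial (Fin (1 + 2 + 1)) K) ∈ ((hypersurfaceι F).left x₀).asHomogeneousIdeal) ∧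
      ∀ (Z : Scheme.{0}) (τ : Z ⟶ (hypersurface F).left), IsBlowup τ (vanishingIdeal ⟨{x₀}, hx₀cl⟩) →
        ∃ S' : Finset Z, (∀ z : Z, τ z = x₀ → z ∉ S' → IsRegularLocalRing (Z.presheaf.stalk z)) ∧
          ∀ z ∈ S', τ z = x₀ ∧ ∃ hz : IsClosed ({z} : Set Z), ∀ (Z' : Scheme.{0}) (τ' : Z' ⟶ Z),
            IsBlowup τ' (vanishingIdeal ⟨{z}, hz⟩) → ∀ z' : Z', τ' z' = z → IsRegularLocalRing (Z'.presheaf.stalk z') := by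
  obtain ⟨hΨ, G, Λ, hG, hjac, hsec⟩ := SecondOrderPoint.twoStepData_D₄_marked' K h2 h3 ζ hζ hfac
  have hΦ : (X 0 ^ 2 : MvPolynomial (Fin 3) K).IsHomogeneous 2 := isHomogeneous_X_pow (0 : Fin 3) 2
  have hΦ0 : (X 0 ^ 2 : MvPolynomial (Fin 3) K) ≠ 0 := pow_ne_zero 2 (X_ne_zero (0 : Fin 3))
  exact twoStepAt_vertex_marked K F hF hd c (X 0 ^ 2) _ (by norm_num) hΦ hΦ0 hΨ hdeh hrad G hG Λ hjac hsec

/-- ★★★ **SEVERAL ONE-STEP AND MARKED TWO-STEP SINGULAR VERTICES ⟹ `IsoHypPoint`** — every dimension, every characteristic; `S₁` = the one-step vertices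
(datum of ✓ `isoHypPoint_of_oneStepVertices`), `S₂` = the two-step vertices with MARKED second-order data (datum of ✓ `twoStepAt_vertex_marked`); marked charts
singular at most at the origin and non-regular there, unmarked charts regular.  Proof of ✓ `isoHypPoint_of_twoStepVertices` (p835865) verbatim. [OURS] [cite: Hartshorne1977, I Thm. 5.1, II Ex. 7.12] [cite: StacksProject, Tag 080E] -/
theorem isoHypPoint_of_twoStepVertices_marked (K : Type) [Field K] [IsAlgClosed K] {m : ℕ}
    (F : MvPolynomial (Fin (m + 2 + 1)) K) {d : ℕ} (hF : F.IsHomogeneous d) (hFp : Prime F)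
    (S₁ S₂ : List (Fin (m + 2 + 1)))
    (hone : ∀ c ∈ S₁, ∃ (μ : ℕ) (Φ Ψ : MvPolynomial (Fin (m + 2)) K), 1 ≤ μ ∧ Φ.IsHomogeneous μ ∧ Φ ≠ 0 ∧
      Ψ ∈ Ideal.span (Set.range (X : Fin (m + 2) → MvPolynomial (Fin (m + 2)) K)) ^ (μ + 1) ∧ ProjectiveSpace.dehomogenize K c F = Φ + Ψ ∧
      ∀ l : Fin (m + 2), ∃ G : MvPolynomial (Fin (m + 2)) K,
        aeval (fun j => X l * Function.update (X : Fin (m + 2) → MvPolynomial (Fin (m + 2)) K) l 1 j) (Φ + Ψ) = X l ^ μ * G ∧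
        ∀ P : Ideal (MvPolynomial (Fin (m + 2)) K), P.IsPrime → (X l : MvPolynomial (Fin (m + 2)) K) ∈ P → G ∈ P → ∃ j, pderiv j G ∉ P)
    (htwo : ∀ c ∈ S₂, ∃ (μ : ℕ) (Φ Ψ : MvPolynomial (Fin (m + 2)) K) (G : Fin (m + 2) → MvPolynomial (Fin (m + 2)) K)
      (Λ : Fin (m + 2) → Finset (Fin (m + 2) → K)),
      1 ≤ μ ∧ Φ.IsHomogeneous μ ∧ Φ ≠ 0 ∧
      Ψ ∈ Ideal.span (Set.range (X : Fin (m + 2) → MvPolynomial (Fin (m + 2)) K)) ^ (μ + 1) ∧ ProjectiveSpace.dehomogenize K c F = Φ + Ψ ∧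
      (∀ a, aeval (fun j => X a * Function.update (X : Fin (m + 2) → MvPolynomial (Fin (m + 2)) K) a 1 j) (Φ + Ψ) = X a ^ μ * G a) ∧
      (∀ a, ∀ P : Ideal (MvPolynomial (Fin (m + 2)) K), P.IsPrime → (X a : MvPolynomial (Fin (m + 2)) K) ∈ P → G a ∈ P →
        (∃ j, pderiv j (G a) ∉ P) ∨ ∃ lam ∈ Λ a, ∀ i, (X i - C (lam i) : MvPolynomial (Fin (m + 2)) K) ∈ P) ∧
      (∀ a, ∀ lam ∈ Λ a, G a ∈ Ideal.span (Set.range fun i : Fin (m + 2) => (X i - C (lam i) : MvPolynomial (Fin (m + 2)) K)) →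
        ∃ (μ' : ℕ) (Φ' Ψ' : MvPolynomial (Fin (m + 2)) K), 1 ≤ μ' ∧ Φ'.IsHomogeneous μ' ∧ Φ' ≠ 0 ∧
          Ψ' ∈ Ideal.span (Set.range (X : Fin (m + 2) → MvPolynomial (Fin (m + 2)) K)) ^ (μ' + 1) ∧
          aeval (fun i => X i + C (lam i)) (G a) = Φ' + Ψ' ∧
          ∀ b : Fin (m + 2), ∃ G' : MvPolynomial (Fin (m + 2)) K,
            aeval (fun j => X b * Function.update (X : Fin (m + 2) → MvPolynomial (Fin (m + 2)) K) b 1 j) (Φ' + Ψ') = X b ^ μ' * G' ∧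
            ∀ P : Ideal (MvPolynomial (Fin (m + 2)) K), P.IsPrime → (X b : MvPolynomial (Fin (m + 2)) K) ∈ P → G' ∈ P → ∃ j, pderiv j G' ∉ P))
    (hsing : ∀ c, c ∈ S₁ ∨ c ∈ S₂ → ∀ P : Ideal (MvPolynomial (Fin (m + 2)) K), P.IsPrime → ProjectiveSpace.dehomogenize K c F ∈ P →
      (∀ j, pderiv j (ProjectiveSpace.dehomogenize K c F) ∈ P) → ∀ j, (X j : MvPolynomial (Fin (m + 2)) K) ∈ P)
    (hsingpt : letI := MvPolynomial.gradedAlgebra (σ := Fin (m + 2 + 1)) (R := K)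
      ∀ c, c ∈ S₁ ∨ c ∈ S₂ → ∀ x : ↥(hypersurface F).left, (∀ a : Fin (m + 2 + 1), a ≠ c →
        (X a : MvPolynomial (Fin (m + 2 + 1)) K) ∈ ((hypersurfaceι F).left x).asHomogeneousIdeal) →
        ¬ IsRegularLocalRing ((hypersurface F).left.presheaf.stalk x))
    (hoff : letI := MvPolynomial.gradedAlgebra (σ := Fin (m + 2 + 1)) (R := K)
      ∀ c, c ∉ S₁ → c ∉ S₂ → IsRegularRing (ChartRing F c hF)) :
    letI := MvPolynomial.gradedAlgebra (σ := Fin (m + 2 + 1)) (R := K)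
    IsoHypPoint K (m + 2) (hypersurface F).left (hypersurfaceι F).left := by
  letI := MvPolynomial.gradedAlgebra (σ := Fin (m + 2 + 1)) (R := K)
  letI := MvPolynomial.gradedAlgebra (σ := Fin (0 + 1)) (R := K)
  classical
  haveI := HypersurfaceSpecimen.isIntegral_hypersurface_of_prime K F hF hFp
  have hd : 0 < d := ConeN.pos_of_prime_of_isHomogeneous K F hF hFp
  have hιinj : Function.Injective (hypersurfaceι F).left := (hypersurfaceι F).left.isClosedEmbedding.injective
  have he : ∀ c : Fin (m + 2 + 1), Function.Injective (fun _ : Fin 1 => c) := fun c => Function.injective_of_subsingleton _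
  have hec : ∀ c : Fin (m + 2 + 1), ∀ j : Fin 1, (fun _ : Fin 1 => c) j = c := fun _ _ => rfl
  have hexk : ∀ c : Fin (m + 2 + 1), ∃ (g : homogeneousSubmodule (Fin (m + 2 + 1)) K →+*ᵍ homogeneousSubmodule (Fin (0 + 1)) K)
      (_ : HomogeneousIdeal.irrelevant (homogeneousSubmodule (Fin (0 + 1)) K) ≤
        (HomogeneousIdeal.irrelevant (homogeneousSubmodule (Fin (m + 2 + 1)) K)).map g),
      (∀ a : K, g (C a) = C a) ∧ (∀ j : Fin 1, g (X ((fun _ : Fin 1 => c) j)) = X j) ∧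
        (∀ i : Fin (m + 2 + 1), i ∉ Set.range (fun _ : Fin 1 => c) → g (X i) = 0) := fun c =>
    LinearCentre.exists_kill (R := K) (fun _ : Fin 1 => c) (he c)
  choose fk hfk' hfkC hfke hfk0 using hexk
  have hfke' : ∀ c (j : Fin 1), fk c (X c) = X j := fun c j => hfke c j
  have hfk0' : ∀ c (i : Fin (m + 2 + 1)), i ≠ c → fk c (X i) = 0 := fun c i hi => hfk0 c i (fun ⟨_, hj⟩ => hi hj.symm)
  -- the splitting `F(x_c := 1) = Φ + Ψ` at every marked vertex
  have hsplit : ∀ c, c ∈ S₁ ∨ c ∈ S₂ → ∃ (μ : ℕ) (Φ Ψ : MvPolynomial (Fin (m + 2)) K), 1 ≤ μ ∧ Φ.IsHomogeneous μ ∧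
      Ψ ∈ Ideal.span (Set.range (X : Fin (m + 2) → MvPolynomial (Fin (m + 2)) K)) ^ (μ + 1) ∧ ProjectiveSpace.dehomogenize K c F = Φ + Ψ := by
    rintro c (hc | hc)
    · obtain ⟨μ, Φ, Ψ, hμ, hΦ, -, hΨ, hdeh, -⟩ := hone c hc
      exact ⟨μ, Φ, Ψ, hμ, hΦ, hΨ, hdeh⟩
    · obtain ⟨μ, Φ, Ψ, -, -, hμ, hΦ, -, hΨ, hdeh, -⟩ := htwo c hc
      exact ⟨μ, Φ, Ψ, hμ, hΦ, hΨ, hdeh⟩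
  -- the chart equation of a marked vertex is radical
  have hrad : ∀ c, c ∈ S₁ ∨ c ∈ S₂ →
      (Ideal.span {ProjectiveSpace.dehomogenize K c F}).radical = Ideal.span {ProjectiveSpace.dehomogenize K c F} := by
    intro c hc
    obtain ⟨μ, Φ, Ψ, hμ, hΦ, hΨ, hdeh⟩ := hsplit c hc
    rw [hdeh]
    exact OrdPointAt.radical_span_dehomogenize_eq K F c hF hFp Φ Ψ hΦ hμ hΨ hdeh
  -- the vertex points of `V₊(F)`, `c ∈ S₁ ∪ S₂`
  have hvert : ∀ c, c ∈ S₁ ∨ c ∈ S₂ → ∃ (x₀ : ↥(hypersurface F).left)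
      (hx₀cl : IsClosed ({(hypersurfaceι F).left x₀} : Set (Proj (homogeneousSubmodule (Fin (m + 2 + 1)) K))))
      (hx₀cl' : IsClosed ({x₀} : Set ↥(hypersurface F).left)),
      ((Proj.map (fk c) (hfk' c)).ker.support : Set (Proj (homogeneousSubmodule (Fin (m + 2 + 1)) K))) = {(hypersurfaceι F).left x₀} ∧
      (∀ a : Fin (m + 2 + 1), a ≠ c → (X a : MvPolynomial (Fin (m + 2 + 1)) K) ∈ ((hypersurfaceι F).left x₀).asHomogeneousIdeal) ∧
      vanishingIdeal ⟨{(hypersurfaceι F).left x₀}, hx₀cl⟩ = (Proj.map (fk c) (hfk' c)).ker ∧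
      ((Proj.map (fk c) (hfk' c)).ker).comap (hypersurfaceι F).left = vanishingIdeal ⟨{x₀}, hx₀cl'⟩ := fun c hc =>
    exists_vertexPoint K F hF c (hsplit c hc) (fk c) (hfk' c) (hfkC c) (hfke' c) (hfk0' c)
  choose xpt hxcl hxcl' hxsupp hxX hxΛ hxcomap using hvert
  -- any point of `V₊(F)` at which all `x_a`, `a ≠ c`, vanish IS the vertex point
  have huniq : ∀ (c : Fin (m + 2 + 1)) (hc : c ∈ S₁ ∨ c ∈ S₂) (x : ↥(hypersurface F).left),
      (∀ a : Fin (m + 2 + 1), a ≠ c → (X a : MvPolynomial (Fin (m + 2 + 1)) K) ∈ ((hypersurfaceι F).left x).asHomogeneousIdeal) →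
      x = xpt c hc := by
    intro c hc x hxXa
    have hxmem : (hypersurfaceι F).left x ∈ ((Proj.map (fk c) (hfk' c)).ker.support : Set (Proj (homogeneousSubmodule (Fin (m + 2 + 1)) K))) := by
      by_contra h
      obtain ⟨a, ha, hXa⟩ := LinearCentre.exists_X_not_mem_of_not_mem_support (fun _ : Fin 1 => c) (he c) (fk c) (hfk' c) (hfkC c) (hfke c)
        (hfk0 c) h
      exact hXa (hxXa a ((OrdPointAt.not_mem_range_iff c (hec c) a).mp ha))
    rw [hxsupp c hc] at hxmem
    exact hιinj (Set.mem_singleton_iff.mp hxmem)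
  -- the finite sets of one-step / two-step singular points
  let SH₁ : Finset ↥(hypersurface F).left := S₁.toFinset.attach.image (fun c => xpt c.1 (Or.inl (List.mem_toFinset.mp c.2)))
  let SH₂ : Finset ↥(hypersurface F).left := S₂.toFinset.attach.image (fun c => xpt c.1 (Or.inr (List.mem_toFinset.mp c.2)))
  have hmemSH₁ : ∀ x, x ∈ SH₁ → ∃ (c : Fin (m + 2 + 1)) (hc : c ∈ S₁), xpt c (Or.inl hc) = x := fun x hx => by
    obtain ⟨c, -, h⟩ := Finset.mem_image.mp hx
    exact ⟨c.1, List.mem_toFinset.mp c.2, h⟩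
  have hmemSH₂ : ∀ x, x ∈ SH₂ → ∃ (c : Fin (m + 2 + 1)) (hc : c ∈ S₂), xpt c (Or.inr hc) = x := fun x hx => by
    obtain ⟨c, -, h⟩ := Finset.mem_image.mp hx
    exact ⟨c.1, List.mem_toFinset.mp c.2, h⟩
  have hmemSH : ∀ x, x ∈ SH₁ ∨ x ∈ SH₂ → ∃ (c : Fin (m + 2 + 1)) (hc : c ∈ S₁ ∨ c ∈ S₂), xpt c hc = x := by
    rintro x (hx | hx)
    · obtain ⟨c, hc, h⟩ := hmemSH₁ x hx; exact ⟨c, Or.inl hc, h⟩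
    · obtain ⟨c, hc, h⟩ := hmemSH₂ x hx; exact ⟨c, Or.inr hc, h⟩
  have hmemSH₁' : ∀ (c : Fin (m + 2 + 1)) (hc : c ∈ S₁), xpt c (Or.inl hc) ∈ SH₁ := fun c hc =>
    Finset.mem_image.mpr ⟨⟨c, List.mem_toFinset.mpr hc⟩, Finset.mem_attach _ _, rfl⟩
  have hmemSH₂' : ∀ (c : Fin (m + 2 + 1)) (hc : c ∈ S₂), xpt c (Or.inr hc) ∈ SH₂ := fun c hc =>
    Finset.mem_image.mpr ⟨⟨c, List.mem_toFinset.mpr hc⟩, Finset.mem_attach _ _, rfl⟩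
  have hmemSH' : ∀ (c : Fin (m + 2 + 1)) (hc : c ∈ S₁ ∨ c ∈ S₂), xpt c hc ∈ SH₁ ∨ xpt c hc ∈ SH₂ := by
    intro c hc
    rcases hc with hc | hc
    · exact Or.inl (hmemSH₁' c hc)
    · exact Or.inr (hmemSH₂' c hc)
  -- the generic point
  obtain ⟨ξ, hξ⟩ : ∃ ξ : ↥(hypersurface F).left, (hypersurfaceι F).left ξ = pointOfPrime F hF hFp := by
    have h : (pointOfPrime F hF hFp : Proj (homogeneousSubmodule (Fin (m + 2 + 1)) K)) ∈ Set.range (hypersurfaceι F).left := by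
      refine (Set.ext_iff.mp (range_hypersurfaceι F) _).mpr ((ProjectiveSpectrum.mem_zeroLocus _ _ _).mpr (Set.singleton_subset_iff.mpr ?_))
      exact Ideal.subset_span rfl
    exact h
  refine isoHypPoint_of_twoStepPoints K (m + 2) (hypersurface F).left (hypersurfaceι F).left SH₁ SH₂ ?_ ?_ ?_ ?_ ?_ ξ ?_
  · -- closed images
    intro x hx
    obtain ⟨c, hc, rfl⟩ := hmemSH x hx
    exact hxcl c hc
  · -- non-regular
    intro x hx
    obtain ⟨c, hc, rfl⟩ := hmemSH x hx
    exact hsingpt c hc _ (hxX c hc)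
  · -- regular off the vertices
    intro x hx₁ hx₂
    refine MultiOrd.isRegularLocalRing_stalk_of_forall_exists K F hF hd (S₁ ++ S₂)
      (fun c hc => ⟨hrad c (List.mem_append.mp hc), hsing c (List.mem_append.mp hc)⟩)
      (fun c hc => hoff c (fun h => hc (List.mem_append.mpr (Or.inl h))) (fun h => hc (List.mem_append.mpr (Or.inr h)))) x (fun c hc => ?_)
    have hc' : c ∈ S₁ ∨ c ∈ S₂ := List.mem_append.mp hc
    have hxc : (hypersurfaceι F).left x ∉ ((Proj.map (fk c) (hfk' c)).ker.support : Set (Proj (homogeneousSubmodule (Fin (m + 2 + 1)) K))) := by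
      rw [hxsupp c hc']
      intro h
      have hxe : x = xpt c hc' := hιinj (Set.mem_singleton_iff.mp h)
      rcases hmemSH' c hc' with h₁ | h₂
      · exact hx₁ (hxe ▸ h₁)
      · exact hx₂ (hxe ▸ h₂)
    obtain ⟨a, ha, hXa⟩ := LinearCentre.exists_X_not_mem_of_not_mem_support (fun _ : Fin 1 => c) (he c) (fk c) (hfk' c) (hfkC c) (hfke c)
      (hfk0 c) hxc
    exact ⟨a, (OrdPointAt.not_mem_range_iff c (hec c) a).mp ha, (Proj.mem_basicOpen _ _ _).mpr hXa⟩
  · -- one-step, pointwise over each vertex of `S₁`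
    intro x hx hxcl₀ Z τ hτ z hz
    obtain ⟨c, hc, rfl⟩ := hmemSH₁ x hx
    obtain ⟨μ, Φ, Ψ, hμ, hΦ, hΦ0, hΨ, hdeh, hG⟩ := hone c hc
    have hτ' : IsBlowup τ (((Proj.map (fk c) (hfk' c)).ker).comap (hypersurfaceι F).left) := by rw [hxcomap c (Or.inl hc)]; exact hτ
    refine OneStep.isRegularLocalRing_stalk_of_isBlowup_comap K F c hF hFp (hec c) (fk c) (hfk' c) (hfkC c) (hfke c) (hfk0 c)
      Φ Ψ hΦ hμ hΦ0 hΨ hdeh hG hτ' z ?_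
    have hgoal : (hypersurfaceι F).left (τ z) ∈ ((Proj.map (fk c) (hfk' c)).ker.support : Set (Proj (homogeneousSubmodule (Fin (m + 2 + 1)) K))) := by
      rw [hz, hxsupp c (Or.inl hc)]; rfl
    rw [Scheme.IdealSheafData.support_comap]
    exact hgoal
  · -- two-step, over each vertex of `S₂`
    intro x hx hxcl₀ Z τ hτ
    obtain ⟨c, hc, rfl⟩ := hmemSH₂ x hx
    obtain ⟨μ, Φ, Ψ, G, Λ, hμ, hΦ, hΦ0, hΨ, hdeh, hG, hjac, hsec⟩ := htwo c hc
    have hradΦ : (Ideal.span {Φ + Ψ}).radical = Ideal.span {Φ + Ψ} := by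
      have h := hrad c (Or.inr hc)
      rwa [hdeh] at h
    obtain ⟨x₀, hx₀cl', hx₀X, htwo₀⟩ := twoStepAt_vertex_marked K F hF hd c Φ Ψ hμ hΦ hΦ0 hΨ hdeh hradΦ G hG Λ hjac hsec
    have hx₀ : x₀ = xpt c (Or.inr hc) := huniq c (Or.inr hc) x₀ hx₀X
    subst hx₀
    exact htwo₀ Z τ hτ
  · -- the generic point is no vertex
    intro x hx h
    obtain ⟨c, hc, rfl⟩ := hmemSH x hx
    obtain ⟨a, hac, ha⟩ := MultiOrd.exists_X_ne_not_mem_span K F hFp c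
    have hmem : (hypersurfaceι F).left ξ ∈ ((Proj.map (fk c) (hfk' c)).ker.support : Set (Proj (homogeneousSubmodule (Fin (m + 2 + 1)) K))) := by
      rw [hxsupp c hc, ← h]; rfl
    rw [hξ] at hmem
    exact ha (LinearCentre.X_mem_asHomogeneousIdeal_of_mem_support (fun _ : Fin 1 => c) (fk c) (hfk' c) (hfkC c) (hfke c) (hfk0 c) hmem
      (fun ⟨_, hj⟩ => hac hj.symm))



/-- ★★ **SEVERAL ONE-STEP AND `D₄` VERTICES OF A PRIME SURFACE ⟹ `IsoHypPoint`** (`2, 3 ≠ 0` in `K`, `t³ + 1` split): `F ∈ K[x₀,…,x₃]` a prime form,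
`S₁` one-step vertices, `S₂` vertices whose chart is the `D₄` specimen `y₀² + (y₁³ + y₂³)`; the `S₁` charts singular at most at the origin, all marked vertices
non-regular, unmarked charts regular.  Then `IsoHypPoint K (1+2) V₊(F) ι` — ✓ `isoHypPoint_of_twoStepVertices_marked` with ✓ `twoStepData_D₄_marked` and
✓ `D₄_singular_only_origin`. [OURS] [cite: Hartshorne1977, I Thm. 5.1, I Ex. 5.6] [cite: StacksProject, Tag 080E] -/
theorem isoHypPoint_of_D₄Vertices (K : Type) [Field K] [IsAlgClosed K] (h2 : (2 : K) ≠ 0) (h3 : (3 : K) ≠ 0)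
    (ζ : Fin 3 → K) (hζ : ∀ k, ζ k ^ 3 = -1)
    (hfac : ∀ i : Fin 3, ((X i - C (ζ 0)) * (X i - C (ζ 1)) * (X i - C (ζ 2)) : MvPolynomial (Fin 3) K) = X i ^ 3 + 1)
    (F : MvPolynomial (Fin (1 + 2 + 1)) K) {d : ℕ} (hF : F.IsHomogeneous d) (hFp : Prime F)
    (S₁ S₂ : List (Fin (1 + 2 + 1)))
    (hone : ∀ c ∈ S₁, ∃ (μ : ℕ) (Φ Ψ : MvPolynomial (Fin (1 + 2)) K), 1 ≤ μ ∧ Φ.IsHomogeneous μ ∧ Φ ≠ 0 ∧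
      Ψ ∈ Ideal.span (Set.range (X : Fin (1 + 2) → MvPolynomial (Fin (1 + 2)) K)) ^ (μ + 1) ∧ ProjectiveSpace.dehomogenize K c F = Φ + Ψ ∧
      ∀ l : Fin (1 + 2), ∃ G : MvPolynomial (Fin (1 + 2)) K,
        aeval (fun j => X l * Function.update (X : Fin (1 + 2) → MvPolynomial (Fin (1 + 2)) K) l 1 j) (Φ + Ψ) = X l ^ μ * G ∧
        ∀ P : Ideal (MvPolynomial (Fin (1 + 2)) K), P.IsPrime → (X l : MvPolynomial (Fin (1 + 2)) K) ∈ P → G ∈ P → ∃ j, pderiv j G ∉ P)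
    (hD₄ : ∀ c ∈ S₂, ProjectiveSpace.dehomogenize K c F = X 0 ^ 2 + (X 1 ^ 3 + X 2 ^ 3))
    (hsing₁ : ∀ c ∈ S₁, ∀ P : Ideal (MvPolynomial (Fin (1 + 2)) K), P.IsPrime → ProjectiveSpace.dehomogenize K c F ∈ P →
      (∀ j, pderiv j (ProjectiveSpace.dehomogenize K c F) ∈ P) → ∀ j, (X j : MvPolynomial (Fin (1 + 2)) K) ∈ P)
    (hsingpt : letI := MvPolynomial.gradedAlgebra (σ := Fin (1 + 2 + 1)) (R := K)
      ∀ c, c ∈ S₁ ∨ c ∈ S₂ → ∀ x : ↥(hypersurface F).left, (∀ a : Fin (1 + 2 + 1), a ≠ c →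
        (X a : MvPolynomial (Fin (1 + 2 + 1)) K) ∈ ((hypersurfaceι F).left x).asHomogeneousIdeal) →
        ¬ IsRegularLocalRing ((hypersurface F).left.presheaf.stalk x))
    (hoff : letI := MvPolynomial.gradedAlgebra (σ := Fin (1 + 2 + 1)) (R := K)
      ∀ c, c ∉ S₁ → c ∉ S₂ → IsRegularRing (ChartRing F c hF)) :
    letI := MvPolynomial.gradedAlgebra (σ := Fin (1 + 2 + 1)) (R := K)
    IsoHypPoint K (1 + 2) (hypersurface F).left (hypersurfaceι F).left := by
  refine isoHypPoint_of_twoStepVertices_marked K F hF hFp S₁ S₂ hone (fun c hc => ?_) (fun c hc => ?_) hsingpt hoff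
  · obtain ⟨hΨ, G, Λ, hG, hjac, hsec⟩ := SecondOrderPoint.twoStepData_D₄_marked' K h2 h3 ζ hζ hfac
    have hΦ : (X 0 ^ 2 : MvPolynomial (Fin 3) K).IsHomogeneous 2 := isHomogeneous_X_pow (0 : Fin 3) 2
    have hΦ0 : (X 0 ^ 2 : MvPolynomial (Fin 3) K) ≠ 0 := pow_ne_zero 2 (X_ne_zero (0 : Fin 3))
    exact ⟨2, X 0 ^ 2, _, G, Λ, by norm_num, hΦ, hΦ0, hΨ, hD₄ c hc, hG, hjac, hsec⟩
  · rcases hc with hc | hc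
    · exact hsing₁ c hc
    · intro P hP hfP hdP j
      rw [hD₄ c hc] at hfP hdP
      exact SecondOrderPoint.D₄_singular_only_origin K h2 h3 P hP hfP hdP j

end Summit.ResolutionOfSingularities.ResolutionOfSingularities.Cruxes.EquisingularLiftNat.Sections

end
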